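import Summits.QuantumFields.BalabanUV.T4Continuum.Support.NE7EJFlatBloch
import Summits.QuantumFields.BalabanUV.T4Continuum.Support.NE7EJTorusAliasWeights
import Summits.QuantumFields.BalabanUV.T4Continuum.Support.NE7EJDefectSpectral

/-!
# NE7EJFlatBlochB — row NE7 (node U5), candidate route HOM, variant H1L-EJ, item EJ-1b′ (T1)–(T3′): LENS 1's THEOREM B AND COROLLARY B1 IN KERNEL
# END TO END ON EVERY EVEN TORUS — `EF^flat(w) ≥ ⟨dw, K(2+K)⁻¹dw⟩ = ⟨w, Hess²(2+Hess)⁻¹w⟩` and `EF^flat(w) ≥ ⟨dw, ψ_a(K)dw⟩ = ⟨w, φ_a(Hess)w⟩`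
# for EVERY `0 < a ≤ 4` ((MI_a)^flat), for all 1-forms `w` on `(ℤ∕2N)²`; the general statement `EF^flat ≥ ⟨dw, (1−g)(K)dw⟩` for every admissible `g`

Lineage `b2b-balaban-t4-ne7-p2` (CRUX PROVER NE7 #2 = C-HOM°'s kernel hand), generation 82; file 131.  Imports 125 `NE7EJFlatBloch` (`EFflat_two_eq`,
`curlT`, `sum_mul_curlT`, `phiHessForm(_eq)`, `flat_master_oneforms`), 130 `NE7EJTorusAliasWeights` (`Admissible`, `master_real_of_admissible`, the real
operators `fKR`, `admissible_gB ∕ _gPade ∕ _hh_B_interp`, `eq_fKR_gB_of_resolvent`), 121 `NE7EJDefectSpectral` (`phiA`, for the docking `x·ψ_a(x) = φ_a(x)`).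

SOURCE (lens 1 = `t4-ne7-idea-1` gen 73, toy P-EJ-15, `t4/ideate/NE7/lens1-g73/FLATPADE-NOTE.md` d2ccf99438315edd, [NE7IDEA1-G73-INBOX] L.53664):
«THEOREM B (SHARP, two lines) — EF^flat ≥ Hess²(2+Hess)⁻¹ = φ₂(Hess)(1+½Hess) ⇔ 4A†A ≤ 2(2−Δ_plaq)⁻¹ ⇔ 1 − S = 4AB … equality on axis blocks»;
«COROLLARY B1: EF^flat − φ_a(Hess) ≥ σ_a(Hess), σ_a(x) = x³(a(4−a)+2x)∕(2(2+x)(a+x)²) > 0 on (0,8] iff a ≤ 4 … (MI_a)^flat for a ≤ 4 from B alone»;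
ERRATUM E-L1-g73-1: «(MI_a)^flat ∀ a ≤ 4» is TRUE (proved by THEOREM A's certificate and by B1) though not by (hh); d = 2, L = 2, one RG step, FLAT
abelian toy — her words «never the NE7 estimate».  Here `EF^flat` = file 122's `EFflat 2 (blkB 2 N)` (`Hess_f − ¼Q†Hess_cQ` with `d_cQ` := B7 (48)'s right
side), `K = −Δ_plaq = CCᵀ` (file 124's `lapR`), `dw = dF w = Cw`; for a profile `ψ` the 1-form operator `φ(Hess) = Cᵀψ(CCᵀ)C` (push-through,
`φ(x) = xψ(x)`, file 119) has the form `⟨w, Cᵀψ(K)Cw⟩ = ⟨dw, ψ(K)dw⟩` (file 125 `sum_mul_curlT`), which is how the statements below are typed.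
THIS FILE:
* §1 **`EFflat_ge_of_admissible`**: for every admissible weight `g` (file 130) and every 1-form `w`, `⟨dw, (1−g)(K)dw⟩ ≤ EF^flat(w)`; the same with the
  adjoint curl written out (`_oneform`: `⟨w, Cᵀ(1−g)(K)Cw⟩ ≤ EF^flat(w)`).
* §2 THEOREM B: **`flat_master_B`** (`⟨dw, ψ_B(K)dw⟩ ≤ EF^flat(w)`, `ψ_B = x∕(2+x)`), `flat_master_B_oneform`, and the OPERATOR-FREE wording
  **`flat_master_B_resolvent`**: for any real `G` with `2G + KG = K(dw)` (i.e. `G = (2+K)⁻¹K·dw`), `Σ_x (dw)(x)G(x) ≤ EF^flat(w)` — «EF^flat ≥ Hess²(2+Hess)⁻¹».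
* §3 COROLLARY B1 = **(MI_a)^flat FOR EVERY `0 < a ≤ 4`**: **`flat_master_pade`** (`⟨dw, ψ_a(K)dw⟩ ≤ EF^flat(w)`, `ψ_a = ½a²x∕(a+x)²`), `_oneform`, the
  docking `mul_psiA_eq_phiA` (`x·ψ_a(x) = phiA a x` of file 121 on `x ≥ 0`, so `⟨dw, ψ_a(K)dw⟩` IS `⟨w, φ_a(Hess)w⟩`), and the slack form
  `flat_master_pade_slack` (`⟨dw, ψ_a(K)dw⟩ + ⟨dw, (ψ_B−ψ_a)(K)dw⟩ ≤ EF^flat(w)`, the second term ≥ 0 — her σ_a).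
* §4 consistency with (hh): `phiHessForm_eq_fKR` (file 125's `⟨w, (½Hess² − ⅛Hess³)w⟩ = ⟨dw, ψ_hh(K)dw⟩`) and `flat_master_hh` re-derived from
  `admissible_gFlat`; §5 the interpolated weights between (hh) and B (`flat_master_interp`, convexity).

HONEST FRAMING: [folklore]; d = 2, L = 2 FLAT ABELIAN TOY RUNG of lens 1's («never the NE7 estimate») — even tori `(ℤ∕2N)²`, profiles `φ_B`, `φ_a (a ≤ 4)`;
her THEOREM A (`a ≤ a♭ = (3+√41)∕2` by a Bernstein certificate) is NOT typed; her curved programme ((MI₂) at ε > 0, (LL_β)) untouched; nothing of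
Bałaban's instantiated beyond B7 (48)'s right side as file 122's definition; NOT a letter move (PRICING-NE7 v56 §413: toy rungs at zero letter); T-50-10
honoured.  NE7 NOT PRINTED ∕ NOT PROVED; spine 0∕9; FIXED FINITE T⁴, rung (B)+1; NOT infinite volume, NOT mass gap, NOT Clay.  HONEST DEPENDENCY:
continuum YM on T⁴ ⇐ BetaPertH ∧ nine spine estimates (0/9 proved); BetaPertH ⇐ (D1) ∧ (D4) ∧ CAP+tail; G-an2-4 gates asym, D1 and NE2/3/4.
-/

noncomputable section

open Finset Complex ZMod

namespace Summit.QuantumFields.BalabanUV.T4Continuum.NE7EJFlatBlochB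

open NE7EJTorusFourier NE7EJTorusAlias NE7EJTorusMultiplier NE7EJTorusAliasWeights NE7EJFlatSecular NE7EJSecularCriterion
  NE7EJFlatDefectLattice NE7EJFlatBloch NE7EJWeightMenu

variable (N : ℕ) [NeZero N]

/-! ### §0 Real-operator bookkeeping (composition, the half-Laplacian) -/

/-- the cast of a real-operator field as a function. [folklore] -/
theorem fKR_coe_fun (g : ℝ → ℝ) (F : XX (2 * N) → ℝ) :
    (fun y => ((fKR g F y : ℝ) : ℂ)) = fK g (fun y => ((F y : ℝ) : ℂ)) := funext (fKR_cast g F)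

/-- composition of real operators: `g(K)(h(K)F) = (g·h)(K)F`. [folklore] -/
theorem fKR_comp (g h : ℝ → ℝ) (F : XX (2 * N) → ℝ) (x : XX (2 * N)) : fKR g (fKR h F) x = fKR (fun t => g t * h t) F x := by
  have e : ((fKR g (fKR h F) x : ℝ) : ℂ) = ((fKR (fun t => g t * h t) F x : ℝ) : ℂ) := by
    rw [fKR_cast, fKR_cast, fKR_coe_fun, fK_comp]
  exact_mod_cast e

/-- the half Laplacian as a real operator: `(t ↦ t∕2)(K)F = ½KF`. [folklore] -/
theorem fKR_half_id (F : XX (2 * N) → ℝ) : fKR (fun t => (1 / 2) * t) F = fun x => (1 / 2) * lapR N F x := by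
  funext x; rw [fKR_smul, lapR_eq_fKR]

/-! ### §1 The general 1-form statement: `EF^flat ≥ ⟨dw, (1 − g)(K)dw⟩` for every admissible `g` -/

/-- **`EF^flat(w) ≥ ⟨dw, (1−g)(K)dw⟩` for every admissible weight `g` and every 1-form `w` on `(ℤ∕2N)²`.** [folklore] -/
theorem EFflat_ge_of_admissible {g : ℝ → ℝ} (hg : Admissible g) (w : XX (2 * N) → Fin 2 → ℝ) :
    ∑ x, dF w x * fKR (fun t => 1 - g t) (dF w) x ≤ EFflat 2 (blkB 2 N) w := by
  rw [EFflat_two_eq]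
  have h := master_real_of_admissible N hg (dF w)
  have e : ∑ x, dF w x * fKR (fun t => 1 - g t) (dF w) x = ∑ x, dF w x ^ 2 - ∑ x, dF w x * fKR g (dF w) x := by
    rw [← sum_sub_distrib]
    refine sum_congr rfl fun x _ => ?_
    rw [fKR_sub, fKR_one]; ring
  rw [e]; linarith

/-- the same with the adjoint curl written out: `⟨w, Cᵀ(1−g)(K)Cw⟩ ≤ EF^flat(w)` (push-through: `Cᵀψ(CCᵀ)C = φ(CᵀC)`, `φ = xψ`). [folklore] -/
theorem EFflat_ge_of_admissible_oneform {g : ℝ → ℝ} (hg : Admissible g) (w : XX (2 * N) → Fin 2 → ℝ) :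
    ∑ x, ∑ μ : Fin 2, w x μ * curlT N (fKR (fun t => 1 - g t) (dF w)) x μ ≤ EFflat 2 (blkB 2 N) w := by
  rw [sum_mul_curlT]; exact EFflat_ge_of_admissible N hg w

/-! ### §2 THEOREM B: `EF^flat ≥ ⟨dw, K(2+K)⁻¹dw⟩ = Hess²(2+Hess)⁻¹` -/

/-- **THEOREM B (lens 1 gen 73) IN KERNEL ON EVERY EVEN TORUS**: `⟨dw, ψ_B(K)dw⟩ ≤ EF^flat(w)` for every 1-form `w`, `ψ_B(x) = x∕(2+x)`. [folklore] -/
theorem flat_master_B (w : XX (2 * N) → Fin 2 → ℝ) : ∑ x, dF w x * fKR psiB (dF w) x ≤ EFflat 2 (blkB 2 N) w := by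
  have h := EFflat_ge_of_admissible N admissible_gB w
  have e : fKR (fun t => 1 - gB t) (dF w) = fKR psiB (dF w) :=
    fKR_congr (fun t ht _ => by rw [gB_eq_one_sub_psiB (by linarith)]; ring) _
  rw [e] at h; exact h

/-- THEOREM B with the adjoint curl written out: `⟨w, Cᵀψ_B(CCᵀ)Cw⟩ = ⟨w, Hess²(2+Hess)⁻¹w⟩ ≤ EF^flat(w)`. [folklore] -/
theorem flat_master_B_oneform (w : XX (2 * N) → Fin 2 → ℝ) :
    ∑ x, ∑ μ : Fin 2, w x μ * curlT N (fKR psiB (dF w)) x μ ≤ EFflat 2 (blkB 2 N) w := by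
  rw [sum_mul_curlT]; exact flat_master_B N w

/-- `ψ_B(K) = g_B(K)∘(½K)`: the profile factorises as `x∕(2+x) = (2∕(2+x))·(x∕2)`. [folklore] -/
theorem fKR_psiB_eq (F : XX (2 * N) → ℝ) : fKR psiB F = fKR gB (fun x => (1 / 2) * lapR N F x) := by
  rw [← fKR_half_id]
  funext x
  rw [fKR_comp]
  exact congrFun (fKR_congr (fun t ht _ => by unfold psiB gB; field_simp) _) x

/-- **THEOREM B, OPERATOR-FREE WORDING**: for every 1-form `w` on `(ℤ∕2N)²` and every real plaquette field `G` with `2G + KG = K(dw)` — i.e.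
`G = (2 − Δ_plaq)⁻¹(−Δ_plaq)dw` — one has `Σ_x (dw)(x)·G(x) ≤ EF^flat(w)`: «EF^flat ≥ Hess²(2+Hess)⁻¹». [folklore] -/
theorem flat_master_B_resolvent (w : XX (2 * N) → Fin 2 → ℝ) (G : XX (2 * N) → ℝ)
    (hG : ∀ x, 2 * G x + lapR N G x = lapR N (dF w) x) : ∑ x, dF w x * G x ≤ EFflat 2 (blkB 2 N) w := by
  have hG' : ∀ x, 2 * G x + lapR N G x = 2 * ((fun y => (1 / 2) * lapR N (dF w) y) x) := fun x => by
    rw [hG x]; simp only; ring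
  have e : G = fKR psiB (dF w) := by rw [eq_fKR_gB_of_resolvent N hG', fKR_psiB_eq]
  rw [e]; exact flat_master_B N w

/-! ### §3 COROLLARY B1: (MI_a)^flat for every `0 < a ≤ 4` -/

/-- **(MI_a)^flat FOR EVERY `0 < a ≤ 4`, IN KERNEL ON EVERY EVEN TORUS** (COROLLARY B1): `⟨dw, ψ_a(K)dw⟩ ≤ EF^flat(w)` for every 1-form `w`,
`ψ_a(x) = ½a²x∕(a+x)²` (so `xψ_a(x) = φ_a(x) = ½x²∕(1+x∕a)²`). [folklore] -/
theorem flat_master_pade {a : ℝ} (ha : 0 < a) (ha4 : a ≤ 4) (w : XX (2 * N) → Fin 2 → ℝ) :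
    ∑ x, dF w x * fKR (psiA a) (dF w) x ≤ EFflat 2 (blkB 2 N) w :=
  le_trans (form_fKR_mono (fun _ hx _ => psiA_le_psiB ha ha4 hx) _) (flat_master_B N w)

/-- (MI_a)^flat with the adjoint curl written out: `⟨w, Cᵀψ_a(CCᵀ)Cw⟩ = ⟨w, φ_a(Hess)w⟩ ≤ EF^flat(w)`, `0 < a ≤ 4`. [folklore] -/
theorem flat_master_pade_oneform {a : ℝ} (ha : 0 < a) (ha4 : a ≤ 4) (w : XX (2 * N) → Fin 2 → ℝ) :
    ∑ x, ∑ μ : Fin 2, w x μ * curlT N (fKR (psiA a) (dF w)) x μ ≤ EFflat 2 (blkB 2 N) w := by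
  rw [sum_mul_curlT]; exact flat_master_pade N ha ha4 w

omit [NeZero N] in
/-- docking to file 121's Padé profile: `x·ψ_a(x) = phiA a x` on `x ≥ 0` (`a > 0`). [folklore] -/
theorem mul_psiA_eq_phiA {a x : ℝ} (ha : 0 < a) (hx : 0 ≤ x) : x * psiA a x = NE7EJDefectSpectral.phiA a x := by
  rw [mul_psiA ha hx]; unfold NE7EJDefectSpectral.phiA; rw [abs_of_nonneg hx]

/-- in Fourier variables the left side of (MI_a)^flat is `M⁻²Σ_p φ_a(ω(p))‖(dw)^(p)‖²∕ω(p)`-type: precisely `M²·⟨dw, ψ_a(K)dw⟩ = Σ_p ψ_a(ω(p))‖(dw)^(p)‖²`.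
[folklore] -/
theorem form_pade_fourier (a : ℝ) (w : XX (2 * N) → Fin 2 → ℝ) :
    (((2 * N : ℕ) : ℝ) ^ 2) * ∑ x, dF w x * fKR (psiA a) (dF w) x
      = ∑ p, psiA a (omegaR p) * ‖fhat (fun y => ((dF w y : ℝ) : ℂ)) p‖ ^ 2 :=
  form_fKR (psiA a) (dF w)

/-- the slack form of COROLLARY B1: `⟨dw, ψ_a(K)dw⟩ + ⟨dw, (ψ_B − ψ_a)(K)dw⟩ ≤ EF^flat(w)` with the second term `≥ 0` for `a ≤ 4` (her `σ_a ≥ 0`).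
[folklore] -/
theorem flat_master_pade_slack (a : ℝ) (w : XX (2 * N) → Fin 2 → ℝ) :
    ∑ x, dF w x * fKR (psiA a) (dF w) x + ∑ x, dF w x * fKR (fun t => psiB t - psiA a t) (dF w) x ≤ EFflat 2 (blkB 2 N) w := by
  have e : ∑ x, dF w x * fKR (psiA a) (dF w) x + ∑ x, dF w x * fKR (fun t => psiB t - psiA a t) (dF w) x
      = ∑ x, dF w x * fKR psiB (dF w) x := by
    rw [← sum_add_distrib]
    refine sum_congr rfl fun x _ => ?_
    rw [fKR_sub]; ring
  rw [e]; exact flat_master_B N w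

/-- and that slack is non-negative for `0 < a ≤ 4`. [folklore] -/
theorem pade_slack_nonneg {a : ℝ} (ha : 0 < a) (ha4 : a ≤ 4) (F : XX (2 * N) → ℝ) :
    0 ≤ ∑ x, F x * fKR (fun t => psiB t - psiA a t) F x :=
  form_fKR_nonneg (fun x hx _ => by linarith [psiA_le_psiB ha ha4 hx]) F

/-! ### §4 Consistency with THEOREM (hh) (file 125) -/

/-- file 125's polynomial form IS the multiplier form: `⟨w, (½Hess² − ⅛Hess³)w⟩ = ⟨dw, ψ_hh(K)dw⟩`. [folklore] -/
theorem phiHessForm_eq_fKR (w : XX (2 * N) → Fin 2 → ℝ) : phiHessForm N w = ∑ x, dF w x * fKR psiHH (dF w) x := by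
  rw [phiHessForm_eq]
  refine sum_congr rfl fun x _ => ?_
  congr 1
  have e1 : fKR psiHH (dF w) x = fKR (fun t => (1 / 2) * t) (dF w) x - fKR (fun t => (1 / 8) * (t * t)) (dF w) x := by
    rw [← fKR_sub]
    exact congrFun (fKR_congr (fun t _ _ => by unfold psiHH; ring) _) x
  have e2 : fKR (fun t => (1 / 8) * (t * t)) (dF w) x = (1 / 8) * lapR N (lapR N (dF w)) x := by
    rw [fKR_smul, ← fKR_comp, lapR_eq_fKR]
    congr 1
    exact (congrFun (congrArg (fKR fun t => t) (funext fun y => lapR_eq_fKR N (dF w) y)) x).symm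
  rw [e1, e2, fKR_smul, lapR_eq_fKR]

/-- THEOREM (hh) re-derived through the generic road (`admissible_gFlat`), agreeing with file 125's `flat_master_oneforms`. [folklore] -/
theorem flat_master_hh (w : XX (2 * N) → Fin 2 → ℝ) : ∑ x, dF w x * fKR psiHH (dF w) x ≤ EFflat 2 (blkB 2 N) w := by
  have h := EFflat_ge_of_admissible N admissible_gFlat w
  have e : fKR (fun t => 1 - gFlat t) (dF w) = fKR psiHH (dF w) := fKR_congr (fun t _ _ => by unfold gFlat psiHH; ring) _
  rw [e] at h; exact h

/-! ### §5 The convex family between (hh) and B -/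

/-- **every interpolated weight works**: for `t ∈ [0,1]` and `g_t := (t∕g_hh + (1−t)∕g_B)⁻¹`, `⟨dw, (1 − g_t)(K)dw⟩ ≤ EF^flat(w)` (lens 1 gen 73 (iii):
the admissible set is convex; (hh) and B are two of its extreme directions). [folklore] -/
theorem flat_master_interp {t : ℝ} (ht0 : 0 ≤ t) (ht1 : t ≤ 1) (w : XX (2 * N) → Fin 2 → ℝ) :
    ∑ x, dF w x * fKR (fun s => 1 - (t / gFlat s + (1 - t) / gB s)⁻¹) (dF w) x ≤ EFflat 2 (blkB 2 N) w :=
  EFflat_ge_of_admissible N (admissible_hh_B_interp ht0 ht1) w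

end Summit.QuantumFields.BalabanUV.T4Continuum.NE7EJFlatBlochB

end
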